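import Mathlib
import Summits.Ventures.PercRepro2.Defs
import Summits.Ventures.PercRepro2.Harris
import Summits.Ventures.PercRepro2.Graph
import Summits.Ventures.PercRepro2.Events
import Summits.Ventures.PercRepro2.THRefutation
import Summits.Ventures.PercRepro2.THExtension
import Summits.Ventures.PercRepro2.KTwoFiveNegative
import Summits.Ventures.PercRepro2.THKTwoFiveEnum
import Summits.Ventures.PercRepro2.THKTwoFive

/-!
# Transport of the three-event form along graph isomorphisms, and (T_h) on `K_{2,5}` at all ten of
its negative pairs (blind cell PercRepro2, mine-a g51)

`THExtension.tForm_extend` transports the form `tForm` along a subgraph embedding with the new edges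
at weight `0`.  When the edge injection is SURJECTIVE there are no new edges, and the transported
weight vector is an arbitrary one: for `ιV : V ↪ V'`, `ιE : E ↪ E'` surjective with
`ends' (ιE e) = (ends e).map ιV` and ANY `p' : E' → R`,

  `tForm ends' p' (ιV s) (ιV x) (liftFam ιV 𝓤) (liftFam ιV 𝓥) = tForm ends (p' ∘ ιE) s x 𝓤 𝓥`

(`tForm_transport`).  Hence `(T_h)` for all admissible weights is invariant under rooted graph
isomorphisms (`th_transport`), in particular under automorphisms fixing the root and the hit vertex
(`th_auto`); the form is also symmetric in `𝓤 ↔ 𝓥` (`tForm_swap`).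

Application: on `K_{2,5}` (root `0`, hit vertex `1`, middle vertices `x_i = mid i`) every injection
`π : Fin 5 → Fin 5` of the middle vertices induces the automorphism `fV π` / `fE π`
(`x_i ↦ x_{π i}`, lower and upper edges carried along), and `THKTwoFive.t_ktwofive` — `(T_h)` at
`({x₀, x₁ ∈ T}, {x₂, x₃, x₄ ∈ T})`, kernel census — becomes `(T_h)` at
`({x_{π 0}, x_{π 1} ∈ T}, {x_{π 2}, x_{π 3}, x_{π 4} ∈ T})` for every admissible weight vector
(`t_ktwofive_perm`), i.e. at EVERY pair `({x_a ∈ T, a ∈ A}, {x_b ∈ T, b ∈ B})` with `A, B` disjoint,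
`|A| = 2`, `|B| = 3` (`t_ktwofive_pairs`) and, by the symmetry, `|A| = 3`, `|B| = 2`
(`t_ktwofive_pairs'`): the 10 unordered (20 ordered) pairs at which the antipodal base case of
`K_{2,5}` is `−3` (MINE-A.md §103.1, §104.3 (C)) are all in the kernel.  No instance, no notation.
-/

namespace Summit.Ventures.PercRepro2

namespace THIso

open Finset THExtension

section Transport

variable {V V' : Type*} {E E' : Type*} [Fintype E] [DecidableEq E] [Fintype E'] [DecidableEq E']
  {R : Type*} [CommRing R]

omit [Fintype E] [DecidableEq E] [Fintype E'] [DecidableEq E'] in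
/-- Extending `p' ∘ ιE` by `0` along a surjective edge injection gives back `p'`. -/
lemma extP_comp_of_surjective (ιE : E ↪ E') (hE : Function.Surjective ιE) (p' : E' → R) :
    extP ιE (p' ∘ ιE) = p' := by
  funext e'
  obtain ⟨e, rfl⟩ := hE e'
  rw [extP_apply]
  rfl

/-- **Transport of the form along a graph isomorphism** (more generally: `ιV` injective, `ιE`
bijective, `ends' (ιE e) = (ends e).map ιV`): for every weight vector `p'` of the target,
`tForm ends' p' (ιV s) (ιV x) (liftFam ιV 𝓤) (liftFam ιV 𝓥) = tForm ends (p' ∘ ιE) s x 𝓤 𝓥`. -/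
theorem tForm_transport (ιV : V ↪ V') (ιE : E ↪ E') (hE : Function.Surjective ιE)
    (ends : E → Sym2 V) (ends' : E' → Sym2 V') (h : ∀ e, ends' (ιE e) = (ends e).map ιV)
    (p' : E' → R) (s x : V) (𝓤 𝓥 : Set (Set V)) :
    tForm ends' p' (ιV s) (ιV x) (liftFam ιV 𝓤) (liftFam ιV 𝓥) =
      tForm ends (p' ∘ ιE) s x 𝓤 𝓥 := by
  have key := tForm_extend ιV ιE ends ends' h (p' ∘ ιE) s x 𝓤 𝓥
  rwa [extP_comp_of_surjective ιE hE] at key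

/-- **The form is symmetric in the two families.** -/
theorem tForm_swap (ends : E → Sym2 V) (p : E → R) (s x : V) (𝓤 𝓥 : Set (Set V)) :
    tForm ends p s x 𝓥 𝓤 = tForm ends p s x 𝓤 𝓥 := by
  unfold tForm
  rw [Set.inter_right_comm (clusterInEvent ends s {T : Set V | x ∈ T}) (clusterInEvent ends s 𝓥),
    Set.inter_comm (clusterInEvent ends s 𝓥) (clusterInEvent ends s 𝓤)]
  ring

omit [Fintype E] [DecidableEq E] [Fintype E'] [DecidableEq E'] in
/-- Precomposition with an edge map preserves admissibility. -/
lemma isProbVec_comp [PartialOrder R] [IsOrderedRing R] (ιE : E → E') {p' : E' → R}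
    (hp : IsProbVec p') : IsProbVec (p' ∘ ιE) :=
  ⟨fun e => hp.nonneg (ιE e), fun e => hp.le_one (ιE e)⟩

/-- **(T_h) for all weights is transported along a rooted graph isomorphism**: if
`0 ≤ tForm ends p s x 𝓤 𝓥` for every admissible `p`, then `0 ≤ tForm ends' p' (ιV s) (ιV x)
(liftFam ιV 𝓤) (liftFam ιV 𝓥)` for every admissible `p'`. -/
theorem th_transport [PartialOrder R] [IsOrderedRing R] (ιV : V ↪ V') (ιE : E ↪ E')
    (hE : Function.Surjective ιE) (ends : E → Sym2 V) (ends' : E' → Sym2 V')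
    (h : ∀ e, ends' (ιE e) = (ends e).map ιV) (s x : V) (𝓤 𝓥 : Set (Set V))
    (hT : ∀ p : E → R, IsProbVec p → 0 ≤ tForm ends p s x 𝓤 𝓥) (p' : E' → R)
    (hp' : IsProbVec p') :
    0 ≤ tForm ends' p' (ιV s) (ιV x) (liftFam ιV 𝓤) (liftFam ιV 𝓥) := by
  rw [tForm_transport ιV ιE hE ends ends' h]
  exact hT _ (isProbVec_comp ιE hp')

/-- **(T_h) for all weights is invariant under automorphisms fixing the root and the hit vertex**
(`ιV`, `ιE` of one graph, `ends (ιE e) = (ends e).map ιV`, `ιV s = s`, `ιV x = x`). -/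
theorem th_auto [PartialOrder R] [IsOrderedRing R] (ιV : V ↪ V) (ιE : E ↪ E)
    (hE : Function.Surjective ιE) (ends : E → Sym2 V) (h : ∀ e, ends (ιE e) = (ends e).map ιV)
    (s x : V) (hs : ιV s = s) (hx : ιV x = x) (𝓤 𝓥 : Set (Set V))
    (hT : ∀ p : E → R, IsProbVec p → 0 ≤ tForm ends p s x 𝓤 𝓥) (p' : E → R)
    (hp' : IsProbVec p') : 0 ≤ tForm ends p' s x (liftFam ιV 𝓤) (liftFam ιV 𝓥) := by
  have := th_transport ιV ιE hE ends ends h s x 𝓤 𝓥 hT p' hp'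
  rwa [hs, hx] at this

/-- `(T_h)` in the cell's explicit form is `0 ≤ tForm`. -/
lemma th_iff_tForm_nonneg [PartialOrder R] [IsOrderedRing R] (ends : E → Sym2 V) (p : E → R)
    (s x : V) (𝓤 𝓥 : Set (Set V)) :
    (prob p (clusterInEvent ends s {T : Set V | x ∈ T} ∩ clusterInEvent ends s 𝓤)
          * prob p (clusterInEvent ends s 𝓥)
        + prob p (clusterInEvent ends s {T : Set V | x ∈ T} ∩ clusterInEvent ends s 𝓥)
          * prob p (clusterInEvent ends s 𝓤) ≤
      prob p (clusterInEvent ends s {T : Set V | x ∈ T} ∩ clusterInEvent ends s 𝓤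
          ∩ clusterInEvent ends s 𝓥)
        + prob p (clusterInEvent ends s {T : Set V | x ∈ T})
          * prob p (clusterInEvent ends s 𝓤 ∩ clusterInEvent ends s 𝓥)) ↔
      0 ≤ tForm ends p s x 𝓤 𝓥 := by
  unfold tForm
  rw [sub_sub, sub_nonneg]

end Transport

section KTwoFiveAut

open KTwoFive

variable (π : Fin 5 → Fin 5)

/-- The vertex map of the automorphism of `K_{2,5}` induced by `π` on the middle vertices: fixes
the root `0` and the hit vertex `1`, sends `x_i` to `x_{π i}`. -/
def fV (v : Fin 7) : Fin 7 := if v.val < 2 then v else mid (π ⟨v.val - 2, by omega⟩)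

/-- The edge map: the lower edge of `x_i` to the lower edge of `x_{π i}`, the upper to the upper. -/
def fE (e : Fin 10) : Fin 10 :=
  if e.val % 2 = 0 then KTwoFive.lo (π ⟨e.val / 2, by omega⟩)
  else KTwoFive.up (π ⟨e.val / 2, by omega⟩)

/-- `fV` fixes the root. -/
lemma fV_zero : fV π 0 = 0 := rfl

/-- `fV` fixes the hit vertex. -/
lemma fV_one : fV π 1 = 1 := rfl

/-- `fV` on a middle vertex. -/
lemma fV_mid (i : Fin 5) : fV π (mid i) = mid (π i) := by
  have h : ¬ (mid i).val < 2 := by simp [mid]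
  have h2 : (⟨(mid i).val - 2, by omega⟩ : Fin 5) = i := by
    apply Fin.ext
    simp [mid]
  simp only [fV, if_neg h, h2]

/-- `fE` on a lower edge. -/
lemma fE_lo (i : Fin 5) : fE π (KTwoFive.lo i) = KTwoFive.lo (π i) := by
  have h : (KTwoFive.lo i).val % 2 = 0 := by simp [KTwoFive.lo]
  have h2 : (⟨(KTwoFive.lo i).val / 2, by omega⟩ : Fin 5) = i := by
    apply Fin.ext
    simp only [KTwoFive.lo]
    omega
  simp only [fE, if_pos h, h2]

/-- `fE` on an upper edge. -/
lemma fE_up (i : Fin 5) : fE π (KTwoFive.up i) = KTwoFive.up (π i) := by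
  have h : ¬ (KTwoFive.up i).val % 2 = 0 := by simp [KTwoFive.up]
  have h2 : (⟨(KTwoFive.up i).val / 2, by omega⟩ : Fin 5) = i := by
    apply Fin.ext
    simp only [KTwoFive.up]
    omega
  simp only [fE, if_neg h, h2]

/-- A vertex of `K_{2,5}` is the root, the hit vertex or a middle vertex. -/
lemma vertex_cases (v : Fin 7) : v = 0 ∨ v = 1 ∨ ∃ i, v = mid i := by
  by_cases h0 : v = 0
  · exact Or.inl h0
  by_cases h1 : v = 1
  · exact Or.inr (Or.inl h1)
  refine Or.inr (Or.inr ⟨⟨v.val - 2, ?_⟩, ?_⟩)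
  · omega
  · have h0' : v.val ≠ 0 := fun h => h0 (Fin.ext h)
    have h1' : v.val ≠ 1 := fun h => h1 (Fin.ext h)
    apply Fin.ext
    simp only [mid]
    omega

/-- `lo` is injective. -/
lemma lo_injective : Function.Injective KTwoFive.lo := by
  intro i j h
  have := congrArg Fin.val h
  change 2 * i.val = 2 * j.val at this
  exact Fin.ext (by omega)

/-- `up` is injective. -/
lemma up_injective : Function.Injective KTwoFive.up := by
  intro i j h
  have := congrArg Fin.val h
  change 2 * i.val + 1 = 2 * j.val + 1 at this
  exact Fin.ext (by omega)

/-- A lower edge is never an upper edge. -/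
lemma lo_ne_up (i j : Fin 5) : KTwoFive.lo i ≠ KTwoFive.up j := by
  intro h
  have := congrArg Fin.val h
  change 2 * i.val = 2 * j.val + 1 at this
  omega

variable {π}

/-- `fV π` is injective when `π` is. -/
lemma fV_injective (hπ : Function.Injective π) : Function.Injective (fV π) := by
  intro v w hvw
  rcases vertex_cases v with rfl | rfl | ⟨i, rfl⟩ <;>
    rcases vertex_cases w with rfl | rfl | ⟨j, rfl⟩
  · rfl
  · rw [fV_zero, fV_one] at hvw; exact absurd hvw (by decide)
  · rw [fV_zero, fV_mid] at hvw; exact absurd hvw.symm (mid_ne_zero _)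
  · rw [fV_one, fV_zero] at hvw; exact absurd hvw (by decide)
  · rfl
  · rw [fV_one, fV_mid] at hvw; exact absurd hvw.symm (mid_ne_one _)
  · rw [fV_zero, fV_mid] at hvw; exact absurd hvw (mid_ne_zero _)
  · rw [fV_one, fV_mid] at hvw; exact absurd hvw (mid_ne_one _)
  · rw [fV_mid, fV_mid] at hvw
    rw [hπ (mid_injective hvw)]

/-- `fE π` is injective when `π` is. -/
lemma fE_injective (hπ : Function.Injective π) : Function.Injective (fE π) := by
  intro e e' hee
  rcases edge_cases e with ⟨i, rfl⟩ | ⟨i, rfl⟩ <;>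
    rcases edge_cases e' with ⟨j, rfl⟩ | ⟨j, rfl⟩
  · rw [fE_lo, fE_lo] at hee
    rw [hπ (lo_injective hee)]
  · rw [fE_lo, fE_up] at hee
    exact absurd hee (lo_ne_up _ _)
  · rw [fE_up, fE_lo] at hee
    exact absurd hee.symm (lo_ne_up _ _)
  · rw [fE_up, fE_up] at hee
    rw [hπ (up_injective hee)]

/-- `fE π` is surjective when `π` is injective (a finite injection). -/
lemma fE_surjective (hπ : Function.Injective π) : Function.Surjective (fE π) :=
  Finite.injective_iff_surjective.1 (fE_injective hπ)

/-- The vertex map as an embedding. -/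
def embV (hπ : Function.Injective π) : Fin 7 ↪ Fin 7 := ⟨fV π, fV_injective hπ⟩

/-- The edge map as an embedding. -/
def embE (hπ : Function.Injective π) : Fin 10 ↪ Fin 10 := ⟨fE π, fE_injective hπ⟩

/-- **`(fV π, fE π)` is a graph automorphism of `K_{2,5}`**: `ends (fE e) = (ends e).map fV`. -/
lemma ends_fE (hπ : Function.Injective π) (e : Fin 10) :
    ends (embE hπ e) = (ends e).map (embV hπ) := by
  rcases edge_cases e with ⟨i, rfl⟩ | ⟨i, rfl⟩
  · show ends (fE π (KTwoFive.lo i)) = (ends (KTwoFive.lo i)).map (fV π)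
    rw [fE_lo, ends_lo, ends_lo, Sym2.map_mk, fV_zero, fV_mid]
  · show ends (fE π (KTwoFive.up i)) = (ends (KTwoFive.up i)).map (fV π)
    rw [fE_up, ends_up, ends_up, Sym2.map_mk, fV_one, fV_mid]

/-- The lifted family `{x₀, x₁ ∈ T}` is `{x_{π 0}, x_{π 1} ∈ T}`. -/
lemma liftFam_𝓤 (hπ : Function.Injective π) :
    liftFam (embV hπ) 𝓤 = {T : Set (Fin 7) | mid (π 0) ∈ T ∧ mid (π 1) ∈ T} := by
  ext T
  show (mid 0 ∈ fV π ⁻¹' T ∧ mid 1 ∈ fV π ⁻¹' T) ↔ _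
  simp only [Set.mem_preimage, fV_mid, Set.mem_setOf_eq]

/-- The lifted family `{x₂, x₃, x₄ ∈ T}` is `{x_{π 2}, x_{π 3}, x_{π 4} ∈ T}`. -/
lemma liftFam_𝓥 (hπ : Function.Injective π) :
    liftFam (embV hπ) 𝓥 = {T : Set (Fin 7) | mid (π 2) ∈ T ∧ mid (π 3) ∈ T ∧ mid (π 4) ∈ T} := by
  ext T
  show (mid 2 ∈ fV π ⁻¹' T ∧ mid 3 ∈ fV π ⁻¹' T ∧ mid 4 ∈ fV π ⁻¹' T) ↔ _
  simp only [Set.mem_preimage, fV_mid, Set.mem_setOf_eq]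

variable {R : Type*} [Field R] [LinearOrder R] [IsStrictOrderedRing R]

/-- `THKTwoFive.t_ktwofive` as `0 ≤ tForm`. -/
lemma tForm_ktwofive_nonneg (p : Fin 10 → R) (hp : IsProbVec p) :
    0 ≤ tForm ends p 0 1 𝓤 𝓥 :=
  (th_iff_tForm_nonneg ends p 0 1 𝓤 𝓥).1 (THKTwoFive.t_ktwofive_explicit p hp)

/-- **THEOREM.** For every injection `π` of the middle vertices and every admissible weight vector,
`(T_h)` holds on `K_{2,5}` at the pair `({x_{π 0}, x_{π 1} ∈ T}, {x_{π 2}, x_{π 3}, x_{π 4} ∈ T})`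
(transport of `THKTwoFive.t_ktwofive` along the automorphism `(fV π, fE π)`). -/
theorem tForm_perm_nonneg (hπ : Function.Injective π) (p : Fin 10 → R) (hp : IsProbVec p) :
    0 ≤ tForm ends p 0 1 {T : Set (Fin 7) | mid (π 0) ∈ T ∧ mid (π 1) ∈ T}
      {T : Set (Fin 7) | mid (π 2) ∈ T ∧ mid (π 3) ∈ T ∧ mid (π 4) ∈ T} := by
  rw [← liftFam_𝓤 hπ, ← liftFam_𝓥 hπ]
  exact th_auto (embV hπ) (embE hπ) (fE_surjective hπ) ends (ends_fE hπ) 0 1 rfl rfl 𝓤 𝓥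
    (fun q hq => tForm_ktwofive_nonneg q hq) p hp

/-- **THEOREM (explicit form).** For every injection `π : Fin 5 → Fin 5` and every admissible `p`:
with `Q = {h ∈ C_r}`, `U = {x_{π 0}, x_{π 1} ∈ C_r}`, `e = {x_{π 2}, x_{π 3}, x_{π 4} ∈ C_r}`,
`P(Q ∩ U) P(e) + P(Q ∩ e) P(U) ≤ P(Q ∩ U ∩ e) + P(Q) P(U ∩ e)`. -/
theorem t_ktwofive_perm (hπ : Function.Injective π) (p : Fin 10 → R) (hp : IsProbVec p) :
    prob p (clusterInEvent ends 0 {T : Set (Fin 7) | (1 : Fin 7) ∈ T}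
          ∩ clusterInEvent ends 0 {T : Set (Fin 7) | mid (π 0) ∈ T ∧ mid (π 1) ∈ T})
        * prob p (clusterInEvent ends 0 {T : Set (Fin 7) | mid (π 2) ∈ T ∧ mid (π 3) ∈ T ∧ mid (π 4) ∈ T})
      + prob p (clusterInEvent ends 0 {T : Set (Fin 7) | (1 : Fin 7) ∈ T}
          ∩ clusterInEvent ends 0 {T : Set (Fin 7) | mid (π 2) ∈ T ∧ mid (π 3) ∈ T ∧ mid (π 4) ∈ T})
        * prob p (clusterInEvent ends 0 {T : Set (Fin 7) | mid (π 0) ∈ T ∧ mid (π 1) ∈ T}) ≤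
      prob p (clusterInEvent ends 0 {T : Set (Fin 7) | (1 : Fin 7) ∈ T}
          ∩ clusterInEvent ends 0 {T : Set (Fin 7) | mid (π 0) ∈ T ∧ mid (π 1) ∈ T}
          ∩ clusterInEvent ends 0 {T : Set (Fin 7) | mid (π 2) ∈ T ∧ mid (π 3) ∈ T ∧ mid (π 4) ∈ T})
        + prob p (clusterInEvent ends 0 {T : Set (Fin 7) | (1 : Fin 7) ∈ T})
          * prob p (clusterInEvent ends 0 {T : Set (Fin 7) | mid (π 0) ∈ T ∧ mid (π 1) ∈ T}
              ∩ clusterInEvent ends 0 {T : Set (Fin 7) | mid (π 2) ∈ T ∧ mid (π 3) ∈ T ∧ mid (π 4) ∈ T}) :=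
  (th_iff_tForm_nonneg ends p 0 1 _ _).2 (tForm_perm_nonneg hπ p hp)

end KTwoFiveAut

section KTwoFivePairs

open KTwoFive

variable {R : Type*} [Field R] [LinearOrder R] [IsStrictOrderedRing R]

/-- The family `{x_a ∈ T for every a ∈ A}` of vertex sets of `K_{2,5}` (a principal up-set). -/
def hitFam (A : Finset (Fin 5)) : Set (Set (Fin 7)) := {T | ∀ a ∈ A, mid a ∈ T}

/-- `hitFam` is an up-set. -/
lemma isUpperSet_hitFam (A : Finset (Fin 5)) : IsUpperSet (hitFam A) :=
  fun _ _ hle hT a ha => hle (hT a ha)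

/-- `hitFam {a, b}`. -/
lemma hitFam_pair (a b : Fin 5) :
    hitFam {a, b} = {T : Set (Fin 7) | mid a ∈ T ∧ mid b ∈ T} := by
  ext T
  simp [hitFam]

/-- `hitFam {a, b, c}`. -/
lemma hitFam_triple (a b c : Fin 5) :
    hitFam {a, b, c} = {T : Set (Fin 7) | mid a ∈ T ∧ mid b ∈ T ∧ mid c ∈ T} := by
  ext T
  simp [hitFam]

/-- The five-entry vector of distinct indices is injective. -/
lemma vec5_injective {a₀ a₁ b₀ b₁ b₂ : Fin 5} (h01 : a₀ ≠ a₁) (h02 : a₀ ≠ b₀) (h03 : a₀ ≠ b₁)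
    (h04 : a₀ ≠ b₂) (h12 : a₁ ≠ b₀) (h13 : a₁ ≠ b₁) (h14 : a₁ ≠ b₂) (h23 : b₀ ≠ b₁)
    (h24 : b₀ ≠ b₂) (h34 : b₁ ≠ b₂) : Function.Injective ![a₀, a₁, b₀, b₁, b₂] := by
  intro i j hij
  fin_cases i <;> fin_cases j <;> first | rfl | exact absurd hij (by assumption) |
    exact absurd hij.symm (by assumption)

/-- **THEOREM.** `(T_h)` holds on `K_{2,5}`, for every admissible weight vector, at every pair
`(𝓤, 𝓥) = ({x_a ∈ T, a ∈ A}, {x_b ∈ T, b ∈ B})` with `A, B ⊆ {0, …, 4}` disjoint, `|A| = 2`,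
`|B| = 3` — the ten pairs at which the antipodal base case is `−3`. -/
theorem tForm_pairs_nonneg (A B : Finset (Fin 5)) (hA : A.card = 2) (hB : B.card = 3)
    (hAB : Disjoint A B) (p : Fin 10 → R) (hp : IsProbVec p) :
    0 ≤ tForm ends p 0 1 (hitFam A) (hitFam B) := by
  obtain ⟨a₀, a₁, h01, rfl⟩ := Finset.card_eq_two.1 hA
  obtain ⟨b₀, b₁, b₂, h23, h24, h34, rfl⟩ := Finset.card_eq_three.1 hB
  rw [Finset.disjoint_left] at hAB
  have h02 : a₀ ≠ b₀ := fun h => hAB (a := a₀) (by simp) (by rw [h]; simp)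
  have h03 : a₀ ≠ b₁ := fun h => hAB (a := a₀) (by simp) (by rw [h]; simp)
  have h04 : a₀ ≠ b₂ := fun h => hAB (a := a₀) (by simp) (by rw [h]; simp)
  have h12 : a₁ ≠ b₀ := fun h => hAB (a := a₁) (by simp) (by rw [h]; simp)
  have h13 : a₁ ≠ b₁ := fun h => hAB (a := a₁) (by simp) (by rw [h]; simp)
  have h14 : a₁ ≠ b₂ := fun h => hAB (a := a₁) (by simp) (by rw [h]; simp)
  have hπ := vec5_injective h01 h02 h03 h04 h12 h13 h14 h23 h24 h34
  have := tForm_perm_nonneg hπ p hp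
  rw [hitFam_pair, hitFam_triple]
  exact this

/-- The same with the families swapped (`|A| = 3`, `|B| = 2`): the ten ordered pairs of the other
orientation, by the symmetry `tForm_swap`. -/
theorem tForm_pairs_nonneg' (A B : Finset (Fin 5)) (hA : A.card = 3) (hB : B.card = 2)
    (hAB : Disjoint A B) (p : Fin 10 → R) (hp : IsProbVec p) :
    0 ≤ tForm ends p 0 1 (hitFam A) (hitFam B) := by
  rw [← tForm_swap]
  exact tForm_pairs_nonneg B A hB hA hAB.symm p hp

/-- **THEOREM (explicit form).** For disjoint `A, B ⊆ Fin 5` with `|A| = 2`, `|B| = 3` and every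
admissible `p`: with `Q = {h ∈ C_r}`, `U = {x_a ∈ C_r, a ∈ A}`, `e = {x_b ∈ C_r, b ∈ B}`,
`P(Q ∩ U) P(e) + P(Q ∩ e) P(U) ≤ P(Q ∩ U ∩ e) + P(Q) P(U ∩ e)`. -/
theorem t_ktwofive_pairs (A B : Finset (Fin 5)) (hA : A.card = 2) (hB : B.card = 3)
    (hAB : Disjoint A B) (p : Fin 10 → R) (hp : IsProbVec p) :
    prob p (clusterInEvent ends 0 {T : Set (Fin 7) | (1 : Fin 7) ∈ T}
          ∩ clusterInEvent ends 0 (hitFam A)) * prob p (clusterInEvent ends 0 (hitFam B))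
      + prob p (clusterInEvent ends 0 {T : Set (Fin 7) | (1 : Fin 7) ∈ T}
          ∩ clusterInEvent ends 0 (hitFam B)) * prob p (clusterInEvent ends 0 (hitFam A)) ≤
      prob p (clusterInEvent ends 0 {T : Set (Fin 7) | (1 : Fin 7) ∈ T}
          ∩ clusterInEvent ends 0 (hitFam A) ∩ clusterInEvent ends 0 (hitFam B))
        + prob p (clusterInEvent ends 0 {T : Set (Fin 7) | (1 : Fin 7) ∈ T})
          * prob p (clusterInEvent ends 0 (hitFam A) ∩ clusterInEvent ends 0 (hitFam B)) :=
  (th_iff_tForm_nonneg ends p 0 1 _ _).2 (tForm_pairs_nonneg A B hA hB hAB p hp)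

/-- **THEOREM (explicit form, the other orientation).** `|A| = 3`, `|B| = 2`. -/
theorem t_ktwofive_pairs' (A B : Finset (Fin 5)) (hA : A.card = 3) (hB : B.card = 2)
    (hAB : Disjoint A B) (p : Fin 10 → R) (hp : IsProbVec p) :
    prob p (clusterInEvent ends 0 {T : Set (Fin 7) | (1 : Fin 7) ∈ T}
          ∩ clusterInEvent ends 0 (hitFam A)) * prob p (clusterInEvent ends 0 (hitFam B))
      + prob p (clusterInEvent ends 0 {T : Set (Fin 7) | (1 : Fin 7) ∈ T}
          ∩ clusterInEvent ends 0 (hitFam B)) * prob p (clusterInEvent ends 0 (hitFam A)) ≤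
      prob p (clusterInEvent ends 0 {T : Set (Fin 7) | (1 : Fin 7) ∈ T}
          ∩ clusterInEvent ends 0 (hitFam A) ∩ clusterInEvent ends 0 (hitFam B))
        + prob p (clusterInEvent ends 0 {T : Set (Fin 7) | (1 : Fin 7) ∈ T})
          * prob p (clusterInEvent ends 0 (hitFam A) ∩ clusterInEvent ends 0 (hitFam B)) :=
  (th_iff_tForm_nonneg ends p 0 1 _ _).2 (tForm_pairs_nonneg' A B hA hB hAB p hp)

end KTwoFivePairs

end THIso

end Summit.Ventures.PercRepro2
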